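import Summits.QuantumAdvantage.QuantumAdvantage.Theses.CubicForrelation
import Summits.QuantumAdvantage.QuantumAdvantage.Theorems.CubicForrelationNearExactIsExactBentDuality
import Summits.QuantumAdvantage.QuantumAdvantage.Theorems.CubicForrelationNearExactIsExactRmWeight
import Summits.QuantumAdvantage.QuantumAdvantage.Theorems.CubicForrelationNearExactIsExactDerivDegree

/-!
# Crux `CubicForrelation.NearExactIsExact` (stmt-QuantumAdvantage-14043) — negative side (cdisprove, gen 8):
  duality is an isometry on bent functions; light bent modifications of an exact pair never stay exact

Negative-side (disprover) lemmas for the crux, in the tree's bent vocabulary of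
`CubicForrelationNearExactIsExactBentDuality` (`W_g(x) = 2^m · (-1)^{d(x)}` says "`g` is bent on `m + m` bits
with Boolean dual `d`", `W` the unnormalised Walsh transform `DerivativeWalsh.W`).

* `di_dual_isometry` — **duality is an isometry.** If `g₁, g₂` are bent with duals `d₁, d₂`, then
  `#{x : d₁ x ≠ d₂ x} = #{x : g₁ x ≠ g₂ x}`. Proof: `W` is linear, so
  `W_{σ(g₁) − σ(g₂)} = 2^m (σ(d₁) − σ(d₂))` pointwise (`σ = (-1)^{·}`); Parseval for real functions
  (`DerivativeWalsh.sum_W_sq`) gives `4^m · Σ_x (σ d₁ x − σ d₂ x)² = 2^{m+m} · Σ_y (σ g₁ y − σ g₂ y)²`, and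
  `(σ a − σ b)² = 4·[a ≠ b]`.
* `di_dual_shift_card` — for a bent MODIFICATION `g ⊕ s` (also bent, dual `d'`) of a bent `g` (dual `d`):
  the dual moves by exactly `wt(s)` bits, `#{x : d x ≠ d' x} = #{y : s y = true}`; and
  `di_forrelation_dual_modified` — the old dual scores exactly `Φ(d, g ⊕ s) = 1 − 2·wt(s)/2^{m+m}` against
  the modified function.
* `di_weight_ge_of_cubic_duals` — **bent functions with cubic duals are `2^{n−3}` apart**: if `g` and `g ⊕ s`
  are both bent with duals of algebraic degree `≤ 3` and `s ≠ 0`, then `2^{m+m} ≤ 8 · wt(s)` (the two cubic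
  duals differ in a nonzero cubic word, which has weight `≥ 2^{m+m−3}` by the landed Reed–Muller minimum weight
  `stub_rmWeight` ∘ `stub_derivDegree`, and the isometry transfers the weight back to `s`). Contrapositive
  `di_not_cubic_dual_of_light_modification`: a bent modification of weight `0 < wt(s) < 2^{m+m−3}` of a bent
  function with cubic dual NEVER has a cubic dual — so (with `bb_forrelation_eq_one_iff`) no cubic `f` is an
  exact partner of it: `di_no_exact_partner_of_light_modification`.

Role in the disproof attempt (DISPROOF.md §15, HOME `run/shared/lean/b2b/cubic-forrelation/`): these are the
load-bearing identities of the flat-modification lemma (§15.1: for `g = c ⊕ 1_A`, `A` a codim-3 flat, the dual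
of `g` differs from the cubic dual of `c` on a set `S` with `|S| = |A| = 2^{n−3}`, exactly the RM(3) minimum
distance — the boundary case of `di_weight_ge_of_cubic_duals`) and of the 4-concatenation probe (§15.4:
`|supp qᵢ| = wt(Qᵢ)` for the dual differences). They say where a counterexample to `NearExactIsExact` can NOT
come from: perturbing the `g` of an exact pair `(c̃, c)` on fewer than `2^{n−3}` points and keeping it bent
always destroys exactness, and the old partner `c̃` then scores exactly `1 − 2wt(s)/2ⁿ ∈ (3/4, 1)` — inside the
window only with a NON-cubic new dual, whose distance to RM(3) is what decides the value (open in general;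
`≤ 7/8` whenever `s` is a codim-3 flat indicator, §15.1).

Sources: O. S. Rothaus, On "bent" functions, J. Combin. Theory Ser. A 20 (1976) 300–305 (the dual of a bent
function is bent); C. Carlet, *Boolean Functions for Cryptography and Coding Theory*, CUP 2021, §6.1
(duality; the isometry is folklore, e.g. Carlet's remark that `f ↦ f̃` preserves Hamming distances between bent
functions) and Thm 7 p. 192 (minimum weight of `RM(d,m)`); F. J. MacWilliams, N. J. A. Sloane, *The Theory of
Error-Correcting Codes* (1977), Ch. 13. Everything below is proved from the tree (`DerivativeWalsh.sum_W_sq`,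
`bb_forrelation_eq_of_dual`, `bb_forrelation_eq_one_iff`, `bb_dual_unique`, `bb_isDegLeFun_bxor`,
`stub_rmWeight`, `stub_derivDegree`); axioms are the standard three. [folklore]
-/

set_option linter.dupNamespace false -- D-0017: single-problem summit ⇒ `QuantumAdvantage.QuantumAdvantage` by design

noncomputable section

namespace Summit.QuantumAdvantage.QuantumAdvantage.Theorems.NearExactIsExact.Negative.DualIsometry

open Finset
open Literature.Computability.QuantumComplexity
open Literature.Computability.QuantumComplexity.DerivativeWalsh (W sum_W_sq)
open Summit.QuantumAdvantage.QuantumAdvantage.Theorems.CubicForrelation.NearExactIsExact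
  (bb_forrelation_eq_of_dual bb_forrelation_eq_one_iff bb_dual_unique bb_isDegLeFun_bxor bb_filter_bxor_eq
   stub_rmWeight stub_derivDegree)

variable {n m : ℕ}

/-! ### Pointwise and linear-algebra helpers -/

/-- `W` is additive: `W_{F − G} = W_F − W_G` (the Walsh transform is a finite sum, linear in the function). -/
theorem di_W_sub (F G : (Fin n → Bool) → ℝ) (x : Fin n → Bool) :
    W (fun y => F y - G y) x = W F x - W G x := by
  simp only [W, sub_mul, sum_sub_distrib]

/-- `((-1)^a − (-1)^b)² = 4·[a ≠ b]` for Booleans `a, b`. -/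
theorem di_signOf_sub_sq (a b : Bool) :
    (signOf a - signOf b) ^ 2 = 4 * (if a ≠ b then (1 : ℝ) else 0) := by
  cases a <;> cases b <;> simp [signOf] <;> norm_num

/-- `Σ_x ((-1)^{f x} − (-1)^{g x})² = 4 · #{x : f x ≠ g x}`. -/
theorem di_sum_signOf_sub_sq (f g : (Fin n → Bool) → Bool) :
    ∑ x, (signOf (f x) - signOf (g x)) ^ 2 = 4 * ((univ.filter fun x => f x ≠ g x).card : ℝ) := by
  simp_rw [di_signOf_sub_sq]
  rw [← mul_sum, sum_boole]

/-! ### Duality is an isometry -/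

/-- **Duality is an isometry on bent functions.** If `g₁` and `g₂` are bent on `m + m` bits with Boolean duals
`d₁`, `d₂` (`W_{gᵢ}(x) = 2^m (-1)^{dᵢ(x)}` for all `x`), then the duals are exactly as far apart as the functions:
`#{x : d₁ x ≠ d₂ x} = #{x : g₁ x ≠ g₂ x}`. (Rothaus 1976 / Carlet 2021 §6.1; folklore.) -/
theorem di_dual_isometry {g₁ g₂ d₁ d₂ : (Fin (m + m) → Bool) → Bool}
    (h₁ : ∀ x, W (fun y => signOf (g₁ y)) x = (2 : ℝ) ^ m * signOf (d₁ x))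
    (h₂ : ∀ x, W (fun y => signOf (g₂ y)) x = (2 : ℝ) ^ m * signOf (d₂ x)) :
    (univ.filter fun x => d₁ x ≠ d₂ x).card = (univ.filter fun x => g₁ x ≠ g₂ x).card := by
  have hP := sum_W_sq (fun y => signOf (g₁ y) - signOf (g₂ y))
  have hW : ∀ x, W (fun y => signOf (g₁ y) - signOf (g₂ y)) x =
      (2 : ℝ) ^ m * (signOf (d₁ x) - signOf (d₂ x)) := fun x => by
    rw [di_W_sub, h₁ x, h₂ x]; ring
  simp_rw [hW, mul_pow, ← mul_sum, di_sum_signOf_sub_sq] at hP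
  have hmm : ((2 : ℝ) ^ m) ^ 2 = (2 : ℝ) ^ (m + m) := by rw [← pow_mul, show m * 2 = m + m by ring]
  rw [hmm] at hP
  have h2 : (0 : ℝ) < (2 : ℝ) ^ (m + m) := by positivity
  have hc : ((univ.filter fun x => d₁ x ≠ d₂ x).card : ℝ) = ((univ.filter fun x => g₁ x ≠ g₂ x).card : ℝ) := by
    have := mul_left_cancel₀ h2.ne' hP
    linarith
  exact_mod_cast hc

/-- `{y : g y ≠ g y ⊕ s y} = {y : s y = true}`. -/
theorem di_filter_ne_bxor (g s : (Fin n → Bool) → Bool) :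
    (univ.filter fun y => g y ≠ (g y ^^ s y)) = univ.filter fun y => s y = true := by
  refine filter_congr fun y _ => ?_
  cases g y <;> cases s y <;> simp

/-- **A bent modification moves the dual by exactly its weight.** If `g` is bent with dual `d` and the
modification `g ⊕ s` is bent with dual `d'`, then `#{x : d x ≠ d' x} = wt(s)`. -/
theorem di_dual_shift_card {g s d d' : (Fin (m + m) → Bool) → Bool}
    (hd : ∀ x, W (fun y => signOf (g y)) x = (2 : ℝ) ^ m * signOf (d x))
    (hd' : ∀ x, W (fun y => signOf (g y ^^ s y)) x = (2 : ℝ) ^ m * signOf (d' x)) :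
    (univ.filter fun x => d x ≠ d' x).card = (univ.filter fun y => s y = true).card := by
  rw [di_dual_isometry hd hd', di_filter_ne_bxor]

/-- **The old dual against the modified function.** With `g`, `g ⊕ s` bent (duals `d`, `d'`):
`Φ(d, g ⊕ s) = 1 − 2·wt(s)/2^{m+m}` exactly — the exact partner `d = g̃` of `g` loses exactly `2wt(s)/2ⁿ`. -/
theorem di_forrelation_dual_modified {g s d d' : (Fin (m + m) → Bool) → Bool}
    (hd : ∀ x, W (fun y => signOf (g y)) x = (2 : ℝ) ^ m * signOf (d x))
    (hd' : ∀ x, W (fun y => signOf (g y ^^ s y)) x = (2 : ℝ) ^ m * signOf (d' x)) :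
    forrelation d (fun y => g y ^^ s y) =
      1 - 2 * ((univ.filter fun y => s y = true).card : ℝ) / 2 ^ (m + m) := by
  rw [bb_forrelation_eq_of_dual d (fun y => g y ^^ s y) d' hd', di_dual_shift_card hd hd']

/-! ### Bent functions with cubic duals are `2^{n-3}` apart -/

/-- **Bent functions with cubic duals form a code of minimum distance `2^{n−3}`.** If `g` and `g ⊕ s` are both
bent on `m + m` bits, both duals have algebraic degree `≤ 3`, and `s` is not identically `false`, then
`2^{m+m} ≤ 8 · wt(s)`. (The duals differ — by `bb_dual_unique` and `s ≠ 0` — in a nonzero word of degree `≤ 3`,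
of weight `≥ 2^{m+m−3}` by the Reed–Muller minimum weight `stub_rmWeight` ∘ `stub_derivDegree`; the isometry
`di_dual_shift_card` carries the weight over to `s`.) No degree hypothesis on `g` itself is needed. -/
theorem di_weight_ge_of_cubic_duals {g s d d' : (Fin (m + m) → Bool) → Bool}
    (hd : ∀ x, W (fun y => signOf (g y)) x = (2 : ℝ) ^ m * signOf (d x))
    (hd' : ∀ x, W (fun y => signOf (g y ^^ s y)) x = (2 : ℝ) ^ m * signOf (d' x))
    (h3 : IsDegLeFun 3 d) (h3' : IsDegLeFun 3 d') (hs : ∃ y, s y = true) :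
    2 ^ (m + m) ≤ 8 * (univ.filter fun y => s y = true).card := by
  -- the difference word of the duals is a nonzero cubic word
  have hex : ∃ x, (d x ^^ d' x) = true := by
    by_contra hnone
    have hdd : d = d' := by
      funext x
      have hx : (d x ^^ d' x) ≠ true := fun h => hnone ⟨x, h⟩
      revert hx
      cases d x <;> cases d' x <;> simp
    -- then the duals coincide, so by the isometry `wt(s) = 0`, contradicting `hs`
    have hcard := di_dual_shift_card hd hd'
    have h0 : (univ.filter fun x => d x ≠ d' x).card = 0 := by
      rw [card_eq_zero, filter_eq_empty_iff]
      intro x _ h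
      exact h (by rw [hdd])
    obtain ⟨y, hy⟩ := hs
    have hpos : 0 < (univ.filter fun y => s y = true).card :=
      card_pos.2 ⟨y, mem_filter.2 ⟨mem_univ _, hy⟩⟩
    omega
  have hw := stub_rmWeight stub_derivDegree (m + m) 3 (fun x => d x ^^ d' x) (bb_isDegLeFun_bxor h3 h3') hex
  rw [bb_filter_bxor_eq, di_dual_shift_card hd hd'] at hw
  simpa using hw

/-- **Light bent modifications never have cubic duals.** If `g` is bent with a dual of degree `≤ 3`, and
`g ⊕ s` is bent with dual `d'`, where `0 < wt(s)` and `8 · wt(s) < 2^{m+m}` (i.e. `wt(s) < 2^{n−3}`, below the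
RM(3) minimum distance), then `d'` does NOT have degree `≤ 3`. -/
theorem di_not_cubic_dual_of_light_modification {g s d d' : (Fin (m + m) → Bool) → Bool}
    (hd : ∀ x, W (fun y => signOf (g y)) x = (2 : ℝ) ^ m * signOf (d x))
    (hd' : ∀ x, W (fun y => signOf (g y ^^ s y)) x = (2 : ℝ) ^ m * signOf (d' x))
    (h3 : IsDegLeFun 3 d) (hs : ∃ y, s y = true)
    (hlight : 8 * (univ.filter fun y => s y = true).card < 2 ^ (m + m)) :
    ¬ IsDegLeFun 3 d' := fun h3' =>
  absurd (di_weight_ge_of_cubic_duals hd hd' h3 h3' hs) (not_le.2 hlight)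

/-- **No exact cubic partner for a light bent modification.** Under the same hypotheses, no Boolean function
`f` of degree `≤ 3` has `Φ(f, g ⊕ s) = 1`: by `bb_forrelation_eq_one_iff` such an `f` would be the dual `d'`,
which is not cubic. In the language of the crux: perturbing the `g`-side of an exact pair on fewer than
`2^{n−3}` points (keeping it bent) always leaves the exact locus `{Φ = 1}`; whether it can land in a window
`(θ, 1)` is then decided by `dist(d', RM(3))`, not by exactness. -/
theorem di_no_exact_partner_of_light_modification {g s d d' : (Fin (m + m) → Bool) → Bool}
    (hd : ∀ x, W (fun y => signOf (g y)) x = (2 : ℝ) ^ m * signOf (d x))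
    (hd' : ∀ x, W (fun y => signOf (g y ^^ s y)) x = (2 : ℝ) ^ m * signOf (d' x))
    (h3 : IsDegLeFun 3 d) (hs : ∃ y, s y = true)
    (hlight : 8 * (univ.filter fun y => s y = true).card < 2 ^ (m + m)) :
    ∀ f : (Fin (m + m) → Bool) → Bool, IsDegLeFun 3 f → forrelation f (fun y => g y ^^ s y) ≠ 1 := by
  intro f hf h1
  have hfd : f = d' := (bb_forrelation_eq_one_iff f (fun y => g y ^^ s y) d' hd').1 h1
  exact di_not_cubic_dual_of_light_modification hd hd' h3 hs hlight (hfd ▸ hf)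

end Summit.QuantumAdvantage.QuantumAdvantage.Theorems.NearExactIsExact.Negative.DualIsometry
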